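import Summits.QuantumFields.BalabanUV.T4Continuum.Spine.NE2BalabanFlatWitness
import Summits.QuantumFields.BalabanUV.T4Continuum.Support.GradedWellBackgroundThreshold
import Summits.QuantumFields.BalabanUV.T4Continuum.Support.SubstrateBackgroundTransporters
import Summits.QuantumFields.BalabanUV.Beta.AdjointCarrierWiringEnd

/-!
# T⁴ programme, spine node NE2 (U1a) — THE ADJOINT GAUGE-FIELD INSTANCE: Bałaban's `R(U) = Ad U` as NE2 transporter DATA and ROOT B's END
# stated ABOUT A LATTICE GAUGE FIELD (dictionary B0, instance half: `Rg := Ad ∘ U` is now a definition, not a reading)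

Cell `pub-balaban-gaps` (YM blitz, track G2, seat ne2 = spine estimate NE2; census `run/shared/lean/pub/pub-balaban-gaps/ne/NE2.md`, repair R5 of
`ne/NE2-R5-PLAN.md`).  Every NE2 END in the tree (`Spine/NE2BalabanThreshold.balaban_final_rate_of_regular`, the graded-well ENDs of `Spine/NE2/…`) is
about Bałaban's typed operator `Δ_a ⊗ 1 + balabanPert (liftR Rg) (gaugeSlot …)` for colour transporters `Rg` that are DATA (`Matrix o o ℂ`).  In
[Balaban1985BackgroundPropagators] (3.3) p.390 the transporter is «R(U(b))», «R(U)X = UXU⁻¹» (p.390), `U` the background lattice gauge field.  The two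
halves of that sentence exist separately in the tree: the β cell's `Beta.AdjointCarrierWiring(End)` (the adjoint representation `adMat c e u` in a
trace-orthonormal hermitian component family `e`, multiplicative, orthogonal, `‖cpx(adMat u) − 1‖ ≤ 2‖u − 1‖`) and the substrate dictionary
`Support/SubstrateBackgroundTransporters` (a `Setup` gauge field read through ANY representation `ι : G →* M_o(ℂ)` as the tower `towerOf P ι U`, with
the (3.35)-shape class `RegularTransporters` in V1 words for `dist1`-REALISING `ι`, i.e. `‖ι g − 1‖ = dist1 g` — true for the defining representation,
FALSE for `Ad`).  THIS FILE joins them: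
 * §1 **`adRep hF : U(N) →* M_ι(ℂ)`** — the complexified adjoint representation as a monoid hom (so it IS an `ι` of the substrate dictionary);
   `adRep_mem_unitaryGroup`, `norm_adRep_le_one`, **`norm_adRep_sub_one_le`** (`‖Ad g − 1‖ ≤ 2·dist1 g`), **`norm_adRep_sub_adRep_le`**
   (`‖Ad g − Ad h‖ ≤ 2‖g − h‖`) — the factor-2 size letter;
 * §2 the substrate's class lemma for representations that are only `dist1`-LIPSCHITZ: **`regularTransporters_towerOf_of_dist`**
   (`‖ι g − 1‖ ≤ κ·dist1 g` ⟹ class `(κα) β`), and the scalar (site-based) tower **`stowerOf`** with `liftR_stowerOf : liftR (stowerOf P ι U) = towerOf P ι U`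
   (ROOT B reads site-based transporters and lifts them itself);
 * §2 also: **`siteTr_transS`** — the model's site transport (`RegularSiteTransporters.siteTr`, the `R(U(Γ_{y,x}))` slot of (3.19)) of `ι ∘ U` IS `ι` of the
   parallel transport of `U` along the tree's (1.7) legs `Γ_{y,x}` (`legsHol`), by multiplicativity of `ι`; `stowerOf_one` (trivial fields ↦ trivial tower);
 * §3 **`regularTransporters_adjointField`**: a tower of `U(N)`-valued lattice gauge fields whose bond variables are within `α·L^{−k}` of `1` and
   lattice-Lipschitz with constant `β·L^{−2k}` (the (3.35) SHAPE, in V1 words, on `U` itself) has its ADJOINT transporter tower in row B5's class with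
   constants `(2α, 2β)`;
 * §4 also: **`towerLimitRate_GW_adjointField_of_regular`** — the Δ1 (multi-region, graded-well) twin: this cell's END
   `GradedWellBackgroundThreshold.towerLimitRate_GW_balaban_of_regular` (gen 0, p341034) at `Rg := stowerOf P (adRep hF) U`, any layer map `layer ≤ m`;
 * §5 NON-VACUITY **`balaban_final_rate_of_adjointField_one`**: at the trivial configurations `U_j ≡ 1` every displayed binder of §4 is discharged
   (`α = β = C = 0`, `hNE3 := NE2BalabanFlatWitness.localRate_flat`, `η := η⋆ ≥ 0`), so the binder set is jointly satisfiable;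
 * §4 **`balaban_final_rate_of_adjointField`** — ROOT B's END OF RECORD instantiated at `Rg := stowerOf P (adRep hF) U`: the lifted King-averaged
   unit-lattice covariances of Bałaban's typed `Δ_a(Ad U_k)`-model converge with rate `L^{−k}`; displayed binders: the two (3.35)-shape hypotheses ON THE
   GAUGE FIELDS, node NE3's `LocalRate` BY NAME (on this tower), `0 < a′`, `2α ≤ η`, `2β ≤ η`, `η ≤ η⋆` — NOTHING ELSE (`2 ≤ L`, `1 ≤ d` come from `Params`).

HONEST FRAMING (T4-DAG p. 1).  MODEL LEVEL.  `U` is ANY family of `U(N)`-valued configurations, one per lattice `T^{(K−k)}` — DATA; it is NOT asserted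
that `U_k` is Bałaban's minimiser `U_k(V)` of [B9] (3.35)'s class in the (3.35)-gauge (that is node NE3's carrier question and the remaining half of B0),
nor that the typed operator equals [B9] (3.26) entry-wise (located residuals: the Weitzenböck/holonomy correction `hodgeCorr` + (3.10)'s `Δ′` = sub-row Δ5,
and Bałaban's composed [B7]-averaging `Q_k(U)` vs the model's covariant line-sum = sub-row D-b; census §4/§5).  Finite torus, linear layer, operator
norm, GLOBAL small field (single region).  NOT [B9] (3.23)–(3.27) as printed; **NE2 (U1a) NOT PROVED** — it stays ONE OPEN label in the count of nine;
spine PROVED 0/9 unchanged; NOT continuum YM, NOT infinite volume / mass gap / Clay.  HONEST DEPENDENCY: continuum YM on T⁴ ⇐ BetaPertH ∧ nine spine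
estimates (0/9 proved); BetaPertH ⇐ (D1) ∧ (D4) ∧ CAP+tail; G-an2-4 gates asym, D1 and NE2/3/4.  No `sorry`; the only `def`s are the hom `adRep` and the
site-based tower `stowerOf` (objects, NOT facts); nothing printed is a hypothesis or a conclusion.
-/

noncomputable section

open scoped BigOperators ComplexConjugate Matrix Matrix.Norms.L2Operator Kronecker

namespace Summit.QuantumFields.BalabanUV.T4Continuum.NE2.AdjointFieldInstance

open Literature.MathematicalPhysics.QuantumFieldTheory.Balaban1983to89
open Literature.MathematicalPhysics.QuantumFieldTheory.Balaban1983to89.B5Prop11Plancherel (Tor fine Cst)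
open Literature.MathematicalPhysics.QuantumFieldTheory.Balaban1983to89.B5G183RateUnitTower (lev lev_neZero)
open Literature.MathematicalPhysics.QuantumFieldTheory.Balaban1983to89.T4EtaRateMin (LocalRate)
open Literature.MathematicalPhysics.QuantumLattice (isUnit_det_of_mem_unitaryGroup unitaryFundamentalRep_apply)
open Summit.QuantumFields.BalabanUV.T4Continuum
open Summit.QuantumFields.BalabanUV.T4Continuum.CovariantAveragingTower (TowerLimitRate)
open Summit.QuantumFields.BalabanUV.T4Continuum.BalabanAveragedTowerUnit (idx Qlev cast_lev')
open Summit.QuantumFields.BalabanUV.T4Continuum.BackgroundResolventTower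
open Summit.QuantumFields.BalabanUV.T4Continuum.KingPairingPlantedLaw
open Summit.QuantumFields.BalabanUV.T4Continuum.BlockPairingGeometry (tau)
open Summit.QuantumFields.BalabanUV.T4Continuum.GramPerturbationLaw (C2gram)
open Summit.QuantumFields.BalabanUV.T4Continuum.NE2FromNE3 (bgReadings)
open Summit.QuantumFields.BalabanUV.T4Continuum.RegularBackgroundTower (RegularTransporters regClass betaNE3)
open Summit.QuantumFields.BalabanUV.T4Continuum.GaugeTermScalarData (QuT Q1)
open Summit.QuantumFields.BalabanUV.T4Continuum.RegularSiteTransporters (siteT)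
open Summit.QuantumFields.BalabanUV.T4Continuum.NestedContourTransport (theta0)
open Summit.QuantumFields.BalabanUV.T4Continuum.NE2BalabanRoot (balabanPert)
open Summit.QuantumFields.BalabanUV.T4Continuum.NE2BalabanGauge (gaugeSlot liftR liftR_apply)
open Summit.QuantumFields.BalabanUV.T4Continuum.NE2BalabanLayerSharp (kappaBs C2Bs)
open Summit.QuantumFields.BalabanUV.T4Continuum.NE2BalabanWiring (epsR CdeltaR)
open Summit.QuantumFields.BalabanUV.T4Continuum.NE2BalabanFinal (kappa4F C4F)
open Summit.QuantumFields.BalabanUV.T4Continuum.NE2BalabanThreshold (etaStar etaStar_pos balaban_final_rate_of_regular)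
open Summit.QuantumFields.BalabanUV.T4Continuum.NE2BalabanFlatWitness (localRate_flat)
open Summit.QuantumFields.BalabanUV.T4Continuum.GaugeTermPerturbationLaw (oneR)
open Summit.QuantumFields.BalabanUV.T4Continuum.RegularSiteTransporters (siteTr legs bdec)
open Summit.QuantumFields.BalabanUV.T4Continuum.SubstrateBackgroundTransporters
open Summit.QuantumFields.BalabanUV.T4Continuum.CovariantAveragingSummand (kappaQ)
open Summit.QuantumFields.BalabanUV.T4Continuum.GradedWellData (regionGW)
open Summit.QuantumFields.BalabanUV.T4Continuum.GradedWellConsistencyTransfer (C1Tc C2GW)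
open Summit.QuantumFields.BalabanUV.T4Continuum.GradedWellSandwichLaw (CSGW)
open Summit.QuantumFields.BalabanUV.T4Continuum.GradedWellDifference (eGW)
open Summit.QuantumFields.BalabanUV.T4Continuum.GradedWellTowerCoercive (gamGWv)
open Summit.QuantumFields.BalabanUV.T4Continuum.GradedWellMassCommutator (CMGW)
open Summit.QuantumFields.BalabanUV.T4Continuum.GradedWellColumnsTwoLevel (CbGW)
open Summit.QuantumFields.BalabanUV.T4Continuum.GradedWellBackground (epsGW)
open Summit.QuantumFields.BalabanUV.T4Continuum.GradedWellBackgroundThreshold (etaStarGW towerLimitRate_GW_balaban_of_regular)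
open Summit.QuantumFields.BalabanUV.Beta.ThinLoopHolonomy (cpxHom conjTranspose_cpxHom norm_cpxHom_le_one)
open Summit.QuantumFields.BalabanUV.Beta.AdjointCarrierWiring
open Summit.QuantumFields.BalabanUV.Beta.AdjointCarrierWiringEnd (CompFamily)

/-! ## §1 The complexified adjoint representation as a monoid hom into colour matrices -/

section AdRep

variable {n : Type} [Fintype n] [DecidableEq n] {ι : Type} [Fintype ι] [DecidableEq ι]
variable {c : ℝ} {Pc : Submodule ℝ (Matrix n n ℂ)} {e : ι → Matrix n n ℂ} (hF : CompFamily c Pc e)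

/-- **BAŁABAN's `R(U) = Ad U` AS NE2 TRANSPORTER DATA**: the adjoint representation of `U(N)` on a trace-orthonormal hermitian component family `e`
(the β cell's `adMat c e`, real orthogonal), complexified to `M_ι(ℂ)`, as a monoid hom — an admissible `ι` of the substrate dictionary
`SubstrateBackgroundTransporters` («e.g. the adjoint representation of U(x, x + ηe_ν)»).
[cite: Balaban1985BackgroundPropagators, (3.3) p.390 «R(U)X = UXU⁻¹» (shape)] [folklore] -/
def adRep : Matrix.unitaryGroup n ℂ →* Matrix ι ι ℂ where
  toFun g := cpxHom (adMat c e (g : Matrix n n ℂ))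
  map_one' := by
    show cpxHom (adMat c e ((1 : Matrix.unitaryGroup n ℂ) : Matrix n n ℂ)) = 1
    rw [OneMemClass.coe_one, adMat_one c e hF.orth, map_one]
  map_mul' g h := by
    show cpxHom (adMat c e ((g * h : Matrix.unitaryGroup n ℂ) : Matrix n n ℂ)) =
      cpxHom (adMat c e (g : Matrix n n ℂ)) * cpxHom (adMat c e (h : Matrix n n ℂ))
    rw [Submonoid.coe_mul, adMat_mul c Pc e hF.mem hF.compl hF.stable _ h.2, map_mul]

/-- unfolding equation. [folklore] -/
theorem adRep_apply (g : Matrix.unitaryGroup n ℂ) : adRep hF g = cpxHom (adMat c e (g : Matrix n n ℂ)) := rfl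

/-- `Ad g` is a unitary colour matrix (real orthogonal, complexified). [folklore] -/
theorem adRep_mem_unitaryGroup (g : Matrix.unitaryGroup n ℂ) : adRep hF g ∈ Matrix.unitaryGroup ι ℂ := by
  rw [Matrix.mem_unitaryGroup_iff, adRep_apply, Matrix.star_eq_conjTranspose, conjTranspose_cpxHom, ← map_mul,
    adMat_mul_transpose_self c Pc e hF.mem hF.compl hF.stable hF.orth g.2, map_one]

/-- `‖Ad g‖ ≤ 1`. [folklore] -/
theorem norm_adRep_le_one (g : Matrix.unitaryGroup n ℂ) : ‖adRep hF g‖ ≤ 1 :=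
  norm_cpxHom_le_one _ (adMat_transpose_mul_self c Pc e hF.mem hF.compl hF.stable hF.orth g.2)

omit [Fintype ι] [DecidableEq ι] in
/-- `dist1` of the tree's `U(N)` gauge group is the operator-norm distance to `1` (unfolding lemma). [folklore] -/
theorem dist1_unitaryGroup [Nonempty n] (g : Matrix.unitaryGroup n ℂ) : GaugeGroup.dist1 g = ‖(g : Matrix n n ℂ) - 1‖ := rfl

/-- **THE SIZE LETTER OF THE ADJOINT REPRESENTATION**: `‖Ad g − 1‖ ≤ 2·dist1 g` (the β cell's `norm_cpx_adMat_sub_one_le` BY NAME). The substrate's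
`dist1`-realising hypothesis `‖ι g − 1‖ = dist1 g` FAILS for `ι = Ad`; this inequality is what replaces it. [folklore] -/
theorem norm_adRep_sub_one_le [Nonempty n] (g : Matrix.unitaryGroup n ℂ) : ‖adRep hF g - 1‖ ≤ 2 * GaugeGroup.dist1 g := by
  rw [dist1_unitaryGroup, adRep_apply]
  exact norm_cpx_adMat_sub_one_le hF.pos Pc hF.herm e hF.mem hF.orth hF.compl hF.stable g.2

/-- **LIPSCHITZ**: `‖Ad g − Ad h‖ ≤ 2·‖g − h‖` for unitaries (`Ad g − Ad h = Ad h·(Ad(h⁻¹g) − 1)`, `‖Ad h‖ ≤ 1`, `‖h⁻¹g − 1‖ = ‖g − h‖`). [folklore] -/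
theorem norm_adRep_sub_adRep_le [Nonempty n] (g h : Matrix.unitaryGroup n ℂ) :
    ‖adRep hF g - adRep hF h‖ ≤ 2 * ‖(g : Matrix n n ℂ) - (h : Matrix n n ℂ)‖ := by
  have hfac : adRep hF g - adRep hF h = adRep hF h * (adRep hF (h⁻¹ * g) - 1) := by
    rw [mul_sub, mul_one, ← map_mul, mul_inv_cancel_left]
  have hdist : ‖((h⁻¹ * g : Matrix.unitaryGroup n ℂ) : Matrix n n ℂ) - 1‖ = ‖(g : Matrix n n ℂ) - (h : Matrix n n ℂ)‖ := by
    have hh : star (h : Matrix n n ℂ) * (h : Matrix n n ℂ) = 1 := Matrix.mem_unitaryGroup_iff'.mp h.2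
    have e1 : ((h⁻¹ * g : Matrix.unitaryGroup n ℂ) : Matrix n n ℂ) - 1 =
        star (h : Matrix n n ℂ) * ((g : Matrix n n ℂ) - (h : Matrix n n ℂ)) := by
      rw [Submonoid.coe_mul, mul_sub, hh]
      rfl
    rw [e1, CStarRing.norm_mem_unitary_mul _ (Unitary.star_mem h.2)]
  calc ‖adRep hF g - adRep hF h‖ = ‖adRep hF h * (adRep hF (h⁻¹ * g) - 1)‖ := by rw [hfac]
    _ ≤ ‖adRep hF h‖ * ‖adRep hF (h⁻¹ * g) - 1‖ := norm_mul_le _ _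
    _ ≤ 1 * (2 * GaugeGroup.dist1 (h⁻¹ * g)) :=
        mul_le_mul (norm_adRep_le_one hF h) (norm_adRep_sub_one_le hF _) (norm_nonneg _) zero_le_one
    _ = 2 * ‖(g : Matrix n n ℂ) - (h : Matrix n n ℂ)‖ := by rw [one_mul, dist1_unitaryGroup, hdist]

end AdRep

/-! ## §2 The substrate class lemma for `dist1`-Lipschitz representations; the site-based tower -/

section Substrate

variable (P : Params) {G : Type*} [GaugeGroup G] {o : Type*} [Fintype o] [DecidableEq o] (ι : G →* Matrix o o ℂ)

variable {P ι} in
/-- the size clause at a level `k ≤ K` for a representation with `‖ι g − 1‖ ≤ κ·dist1 g`. [folklore] -/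
theorem size_towerOf_of_dist {κ : ℝ} (hκ : 0 ≤ κ) (hdist : ∀ g, ‖ι g - 1‖ ≤ κ * GaugeGroup.dist1 g)
    (U : (j : ℕ) → GaugeField P j G) {k : ℕ} (hk : k ≤ P.K) {α : ℝ}
    (hU : ∀ b : PBond P (P.K - k), (P.L : ℝ) ^ k * GaugeGroup.dist1 (U (P.K - k) b) ≤ α) (ν : Fin P.d) (i : idx P.L (unitMod P) k) :
    ‖((lev P.L k : ℕ) : ℂ) • (towerOf P ι U k ν i - 1)‖ ≤ κ * α := by
  rw [towerOf_of_le ι U hk, norm_smul, transV_apply, norm_lev]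
  have hL : 0 ≤ (P.L : ℝ) ^ k := by positivity
  calc (P.L : ℝ) ^ k * ‖ι (U (P.K - k) ⟨_, ν⟩) - 1‖
      ≤ (P.L : ℝ) ^ k * (κ * GaugeGroup.dist1 (U (P.K - k) ⟨_, ν⟩)) := mul_le_mul_of_nonneg_left (hdist _) hL
    _ = κ * ((P.L : ℝ) ^ k * GaugeGroup.dist1 (U (P.K - k) ⟨_, ν⟩)) := by ring
    _ ≤ κ * α := mul_le_mul_of_nonneg_left (hU _) hκ

variable {P ι} in
/-- **THE (3.35)-SHAPE CLASS IN V1 WORDS FOR A `dist1`-LIPSCHITZ REPRESENTATION** (`‖ι g − 1‖ ≤ κ·dist1 g`, e.g. `κ = 2` for `Ad`): bond variables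
within `α·L^{−k}` of `1` and `ι`-images lattice-Lipschitz with constant `β·L^{−2k}` at every level `j = K − k` GIVE
`RegularTransporters P.L (unitMod P) (towerOf P ι U) (κα) β` (the substrate's `regularTransporters_towerOf` is the case `κ = 1` with equality).
[cite: Balaban1985BackgroundPropagators, (3.35) p.396 (shape)] [folklore] -/
theorem regularTransporters_towerOf_of_dist {κ : ℝ} (hκ : 0 ≤ κ) (hdist : ∀ g, ‖ι g - 1‖ ≤ κ * GaugeGroup.dist1 g)
    (U : (j : ℕ) → GaugeField P j G) {α β : ℝ} (hα : 0 ≤ α) (hβ : 0 ≤ β)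
    (hsize : ∀ k, k ≤ P.K → ∀ b : PBond P (P.K - k), (P.L : ℝ) ^ k * GaugeGroup.dist1 (U (P.K - k) b) ≤ α)
    (hlip : ∀ k, k ≤ P.K → ∀ (x : Site P (P.K - k)) (ν μ : Fin P.d),
      (P.L : ℝ) ^ k * ‖ι (U (P.K - k) ⟨x.shift μ, ν⟩) - ι (U (P.K - k) ⟨x, ν⟩)‖ ≤ β / (P.L : ℝ) ^ k) :
    RegularTransporters P.L (unitMod P) (towerOf P ι U) (κ * α) β where
  nonneg := ⟨mul_nonneg hκ hα, hβ⟩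
  size := fun k ν i => by
    rcases le_or_gt k P.K with hk | hk
    · exact size_towerOf_of_dist hκ hdist U hk (hsize k hk) ν i
    · exact size_towerOf_of_lt U hk (mul_nonneg hκ hα) ν i
  lipschitz := fun k ν μ i => by
    rcases le_or_gt k P.K with hk | hk
    · exact lipschitz_towerOf_of_le U hk (hlip k hk) ν μ i
    · exact lipschitz_towerOf_of_lt U hk hβ ν μ i

/-- **THE SITE-BASED (scalar, 0-form) TRANSPORTER TOWER OF A RUN** `R^{(k)}_ν(x) := ι (U_{K−k}(x, x + e_ν))` — the datum `Rg` that ROOT B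
(`Spine/NE2BalabanThreshold`) reads (it lifts it to 1-forms by `NE2BalabanGauge.liftR` and builds the site transports `siteT` of the gauge term from it);
levels `k > K` (no V1 lattice) set to `1`. [folklore] -/
def stowerOf (U : (j : ℕ) → GaugeField P j G) (k : ℕ) : Fin P.d → (Tor (fine (lev P.L k) (unitMod P)) → Matrix o o ℂ) :=
  if h : k ≤ P.K then transS (siteIdx P (j := P.K - k) (k := k) (by omega)) ι (U (P.K - k)) else fun _ _ => 1

variable {P ι} in
/-- the lift of the site-based tower IS the substrate's (component-blind) 1-form tower. [folklore] -/
theorem liftR_stowerOf (U : (j : ℕ) → GaugeField P j G) : liftR P.L (unitMod P) (stowerOf P ι U) = towerOf P ι U := by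
  funext k ν i
  rw [liftR_apply]
  unfold stowerOf towerOf
  split_ifs with h
  · rfl
  · rfl

variable {P ι} in
/-- trivial configurations have the trivial site-based tower (`GaugeTermPerturbationLaw.oneR`). [folklore] -/
theorem stowerOf_one : stowerOf P ι (fun j => (1 : GaugeField P j G)) = oneR P.L (unitMod P) := by
  funext k ν x
  unfold stowerOf
  split_ifs with h
  · rw [transS_one]
  · rfl

/-- the `G`-valued PARALLEL TRANSPORT of a configuration along the tree's (1.7) legs `Γ_{y,x}` from the block base point to `x` (ordered product of the
bond variables met along `RegularSiteTransporters.legs`), relative to a chart `e`. [cite: Balaban1984PropagatorsI, (1.7) p.18 (shape)] [folklore] -/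
def legsHol {j : ℕ} {n : ℕ} [NeZero n] {M : Fin P.d → ℕ} [∀ μ, NeZero (M μ)] (e : Site P j ≃ Tor (fine n M)) (U : GaugeField P j G)
    (x : Tor (fine n M)) : G :=
  (((legs n M (bdec n M x).1 (bdec n M x).2).map fun b => U ⟨e.symm b.1, b.2⟩)).prod

variable {P ι} in
/-- **THE `R(U(Γ_{y,x}))` SLOT OF (3.19)**: the model's site transport of the `ι`-transporters of `U` is `ι` of the parallel transport of `U` along the legs —
`siteTr n M (transS e ι U) x = ι (legsHol P e U x)` (multiplicativity of `ι`).  The legs are the tree's straight (1.7) legs; whether they are print's contours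
`Γ^{(j)}_{y,x}` of [Balaban1985Averaging] (52)–(53) is the contour convention recorded in `Literature/…/AveragingRT` §4 (axial case), not asserted here.
[cite: Balaban1985BackgroundPropagators, (3.19) p.393 «(Q′(U)λ)(y) = Σ_{x∈B(y)} L^{−d} R(U(Γ_{y,x}))λ(x)» (shape)] [folklore] -/
theorem siteTr_transS {j : ℕ} {n : ℕ} [NeZero n] {M : Fin P.d → ℕ} [∀ μ, NeZero (M μ)] (e : Site P j ≃ Tor (fine n M)) (U : GaugeField P j G)
    (x : Tor (fine n M)) : siteTr n M (transS e ι U) x = ι (legsHol P e U x) := by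
  rw [siteTr, legsHol, map_list_prod, List.map_map]
  rfl

end Substrate

/-! ## §3 The adjoint transporter tower of a `U(N)` gauge-field tower lies in row B5's class -/

section AdjointClass

variable {n : Type} [Fintype n] [DecidableEq n] [Nonempty n] {ι : Type} [Fintype ι] [DecidableEq ι]
variable {c : ℝ} {Pc : Submodule ℝ (Matrix n n ℂ)} {e : ι → Matrix n n ℂ} (hF : CompFamily c Pc e) (P : Params)

/-- **THE (3.35)-SHAPE CLASS OF THE ADJOINT TOWER, FROM HYPOTHESES ON THE GAUGE FIELDS THEMSELVES**: if at every level `j = K − k` the bond variables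
`U_j(b) ∈ U(N)` are within `α·L^{−k}` of `1` (operator norm) and lattice-Lipschitz `‖U_j(x + e_μ, ν) − U_j(x, ν)‖ ≤ β·L^{−2k}`, then the ADJOINT
transporter tower lies in `RegularTransporters P.L (unitMod P) (liftR (stowerOf P (adRep hF) U)) (2α) (2β)`.  Hypothesis shapes on DATA `U`; no
configuration is asserted regular. [cite: Balaban1985BackgroundPropagators, (3.35) p.396 (shape)] [folklore] -/
theorem regularTransporters_adjointField (U : (j : ℕ) → GaugeField P j (Matrix.unitaryGroup n ℂ)) {α β : ℝ} (hα : 0 ≤ α) (hβ : 0 ≤ β)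
    (hsize : ∀ k, k ≤ P.K → ∀ b : PBond P (P.K - k), (P.L : ℝ) ^ k * ‖((U (P.K - k) b : Matrix.unitaryGroup n ℂ) : Matrix n n ℂ) - 1‖ ≤ α)
    (hlip : ∀ k, k ≤ P.K → ∀ (x : Site P (P.K - k)) (ν μ : Fin P.d),
      (P.L : ℝ) ^ k * ‖((U (P.K - k) ⟨x.shift μ, ν⟩ : Matrix.unitaryGroup n ℂ) : Matrix n n ℂ) - (U (P.K - k) ⟨x, ν⟩ : Matrix n n ℂ)‖
        ≤ β / (P.L : ℝ) ^ k) :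
    RegularTransporters P.L (unitMod P) (liftR P.L (unitMod P) (stowerOf P (adRep hF) U)) (2 * α) (2 * β) := by
  rw [liftR_stowerOf]
  refine regularTransporters_towerOf_of_dist (κ := 2) (by norm_num) (norm_adRep_sub_one_le hF) U hα (by positivity) ?_ ?_
  · intro k hk b
    rw [dist1_unitaryGroup]
    exact hsize k hk b
  · intro k hk x ν μ
    have hL : 0 ≤ (P.L : ℝ) ^ k := by positivity
    calc (P.L : ℝ) ^ k * ‖adRep hF (U (P.K - k) ⟨x.shift μ, ν⟩) - adRep hF (U (P.K - k) ⟨x, ν⟩)‖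
        ≤ (P.L : ℝ) ^ k * (2 * ‖((U (P.K - k) ⟨x.shift μ, ν⟩ : Matrix.unitaryGroup n ℂ) : Matrix n n ℂ)
            - (U (P.K - k) ⟨x, ν⟩ : Matrix n n ℂ)‖) := mul_le_mul_of_nonneg_left (norm_adRep_sub_adRep_le hF _ _) hL
      _ = 2 * ((P.L : ℝ) ^ k * ‖((U (P.K - k) ⟨x.shift μ, ν⟩ : Matrix.unitaryGroup n ℂ) : Matrix n n ℂ)
            - (U (P.K - k) ⟨x, ν⟩ : Matrix n n ℂ)‖) := by ring
      _ ≤ 2 * (β / (P.L : ℝ) ^ k) := mul_le_mul_of_nonneg_left (hlip k hk x ν μ) (by norm_num)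
      _ = 2 * β / (P.L : ℝ) ^ k := by ring

end AdjointClass

/-! ## §4 ROOT B's END OF RECORD stated about a `U(N)` lattice gauge-field tower through `Ad` -/

section RootB

variable {n : Type} [Fintype n] [DecidableEq n] [Nonempty n] {ι : Type} [Fintype ι] [DecidableEq ι]
variable {c : ℝ} {Pc : Submodule ℝ (Matrix n n ℂ)} {e : ι → Matrix n n ℂ} (hF : CompFamily c Pc e) (P : Params) (a : ℝ) (ha : 0 < a)

/-- **ROOT B FOR THE ADJOINT TRANSPORTERS OF A `U(N)` GAUGE-FIELD TOWER** — `Spine/NE2BalabanThreshold.balaban_final_rate_of_regular` (the END OF RECORD of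
the single-region resolvent route) at `Rg := stowerOf P (adRep hF) U`, `R(U) = Ad U` in the component family `e` ([B9] (3.3) p.390 «R(U)X = UXU⁻¹»):
for a family `U` of `U(N)`-valued configurations (one per lattice `T^{(K−k)}`) whose bond variables are within `α·L^{−k}` of `1` and lattice-Lipschitz with
constant `β·L^{−2k}` (the (3.35) SHAPE on `U`), and whose adjoint coefficient towers `{w, Dw}` obey NODE NE3's `LocalRate … C L⁻¹` (BY NAME, OPEN), the lifted
King-averaged unit-lattice covariances of `(Δ_a^{(k)} ⊗ 1 + P_k(Ad U))⁻¹` — `P` Bałaban's typed model of `Δ_a(U) − Δ_a ⊗ 1` (covariant Laplacian + covariant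
line-sum averaging + gauge term with site transports along the (1.7) legs) — CONVERGE with rate `L^{−k}` under the explicit threshold `2α, 2β ≤ η ≤ η⋆(card ι, d, a, a′)`.
Displayed binders: `hsize`, `hlip` (on `U`), `hNE3`, `0 < a′`, `2α ≤ η`, `2β ≤ η`, `η ≤ etaStar ι P.d a a′` — NOTHING ELSE.  MODEL LEVEL: `U` is DATA (NOT
asserted to be Bałaban's minimisers `U_k(V)`), the operator is the tree's typed model (NOT [B9] (3.26) entry-wise: residuals Δ5 = `hodgeCorr` + (3.10)'s `Δ′`,
D-b = [B7]-averaging vs line-sum); NE2 (U1a) is NOT proved by this; spine PROVED 0/9 unchanged.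
[cite: Balaban1985BackgroundPropagators, (3.3) p.390, (3.26) p.395, (3.35) p.396 (shapes)] [folklore] -/
theorem balaban_final_rate_of_adjointField (U : (j : ℕ) → GaugeField P j (Matrix.unitaryGroup n ℂ)) {α β : ℝ} (hα : 0 ≤ α) (hβ : 0 ≤ β)
    (hsize : ∀ k, k ≤ P.K → ∀ b : PBond P (P.K - k), (P.L : ℝ) ^ k * ‖((U (P.K - k) b : Matrix.unitaryGroup n ℂ) : Matrix n n ℂ) - 1‖ ≤ α)
    (hlip : ∀ k, k ≤ P.K → ∀ (x : Site P (P.K - k)) (ν μ : Fin P.d),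
      (P.L : ℝ) ^ k * ‖((U (P.K - k) ⟨x.shift μ, ν⟩ : Matrix.unitaryGroup n ℂ) : Matrix n n ℂ) - (U (P.K - k) ⟨x, ν⟩ : Matrix n n ℂ)‖
        ≤ β / (P.L : ℝ) ^ k)
    {C : ℝ} (hC : 0 ≤ C)
    (hNE3 : LocalRate (bgReadings P.L (unitMod P) (regClass P.L (unitMod P) (liftR P.L (unitMod P) (stowerOf P (adRep hF) U)))) C ((P.L : ℝ)⁻¹))
    {a' : ℝ} (ha' : 0 < a') {η : ℝ} (hαη : 2 * α ≤ η) (hβη : 2 * β ≤ η) (hη : η ≤ etaStar ι P.d a a') :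
    TowerLimitRate (fun k => Qlev P.L (unitMod P) k ⊗ₖ (1 : Matrix ι ι ℂ)) ((P.L : ℝ) ^ P.d)
      (fun k => (calDalev P.L (unitMod P) a ha k ⊗ₖ (1 : Matrix ι ι ℂ)
        + balabanPert P.L (unitMod P) a (liftR P.L (unitMod P) (stowerOf P (adRep hF) U))
            (gaugeSlot P.L (unitMod P) (stowerOf P (adRep hF) U)
              (QuT P.L (unitMod P) ι (siteT P.L (unitMod P) (stowerOf P (adRep hF) U))) (Q1 P.L (unitMod P) ι) a') k)⁻¹)
      (Cpert (kappaBs ι P.d a (2 * α) (2 * β) (a * (epsR ι P.d (2 * α) * (2 + epsR ι P.d (2 * α)) * Cst P.d a))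
          (kappa4F P.d a a' (2 * α) (2 * β)))
        (2 * P.d * Cst P.d a) (CJ P.d a)
        (C2Bs ι P.d P.L a (2 * α) (2 * β) C
          (a * C2gram (Cst P.d a) 1 (epsR ι P.d (2 * α)) (2 * P.d * Cst P.d a) (CJ P.d a) (Cst P.d a)
            (CdeltaR ι P.d a (2 * α) (theta0 P.d (2 * α) (betaNE3 ι C))))
          (C4F ι P.d P.L a a' (2 * α) (2 * β) C)) 0 1) ((P.L : ℝ)⁻¹) :=
  balaban_final_rate_of_regular P.L (unitMod P) a ha P.hL.2 P.hd (regularTransporters_adjointField hF P U hα hβ hsize hlip) hC hNE3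
    ha' hαη hβη hη

include ha in
/-- **THE Δ1 (GRADED-WELL) TWIN AT THE ADJOINT FIELD**: this cell's END `GradedWellBackgroundThreshold.towerLimitRate_GW_balaban_of_regular` (Bałaban's typed `P_B`
over the graded well — print's graded absorber [B9] (3.16)/(3.24)–(3.26) for the region geometry of ANY layer map `layer ≤ m`, model level) at `Rg := stowerOf P (adRep hF) U`:
displayed binders `hsize`/`hlip` (the (3.35) SHAPE on the `U(N)` gauge fields), `hNE3` BY NAME, `layer ≤ m`, `0 < a`, `0 < b′`, `2α ≤ η`, `2β ≤ η`,
`η ≤ etaStarGW ι d L m a a′ b′`.  MODEL LEVEL (`m` fixed; `U` DATA, not asserted to be Bałaban's minimisers); NE2 (U1a) NOT proved by this; 0/9 unchanged.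
[cite: Balaban1985BackgroundPropagators, (3.16) p.393, (3.24)–(3.27) pp.394–395, (3.35) p.396 (shapes)] [folklore] -/
theorem towerLimitRate_GW_adjointField_of_regular (m : ℕ) (layer : Tor (unitMod P) → ℕ) (hlay : ∀ y, layer y ≤ m) {a' : ℝ} (ha' : 0 < a')
    (U : (j : ℕ) → GaugeField P j (Matrix.unitaryGroup n ℂ)) {α β : ℝ} (hα : 0 ≤ α) (hβ : 0 ≤ β)
    (hsize : ∀ k, k ≤ P.K → ∀ b : PBond P (P.K - k), (P.L : ℝ) ^ k * ‖((U (P.K - k) b : Matrix.unitaryGroup n ℂ) : Matrix n n ℂ) - 1‖ ≤ α)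
    (hlip : ∀ k, k ≤ P.K → ∀ (x : Site P (P.K - k)) (ν μ : Fin P.d),
      (P.L : ℝ) ^ k * ‖((U (P.K - k) ⟨x.shift μ, ν⟩ : Matrix.unitaryGroup n ℂ) : Matrix n n ℂ) - (U (P.K - k) ⟨x, ν⟩ : Matrix n n ℂ)‖
        ≤ β / (P.L : ℝ) ^ k)
    {C : ℝ} (hC : 0 ≤ C)
    (hNE3 : LocalRate (bgReadings P.L (unitMod P) (regClass P.L (unitMod P) (liftR P.L (unitMod P) (stowerOf P (adRep hF) U)))) C ((P.L : ℝ)⁻¹))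
    {b' : ℝ} (hb' : 0 < b') {η : ℝ} (hαη : 2 * α ≤ η) (hβη : 2 * β ≤ η) (hη : η ≤ etaStarGW ι P.d P.L m a a' b') :
    TowerLimitRate (ι := fun k => idx P.L (unitMod P) (m + k) × ι) (fun k => Qlev P.L (unitMod P) (m + k) ⊗ₖ (1 : Matrix ι ι ℂ)) ((P.L : ℝ) ^ P.d)
      (fun k => (regionGW P.L (unitMod P) (m + k) m layer a a' ⊗ₖ (1 : Matrix ι ι ℂ)
        + balabanPert P.L (unitMod P) a (liftR P.L (unitMod P) (stowerOf P (adRep hF) U))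
            (gaugeSlot P.L (unitMod P) (stowerOf P (adRep hF) U)
              (QuT P.L (unitMod P) ι (siteT P.L (unitMod P) (stowerOf P (adRep hF) U))) (Q1 P.L (unitMod P) ι) b') (m + k))⁻¹)
      (Cpert (kappaBs ι P.d a (2 * α) (2 * β) (kappaQ P.d a (a : ℂ) (epsR ι P.d (2 * α))) (kappa4F P.d a b' (2 * α) (2 * β))
          * (1 + epsGW P.d P.L m a a'))
        ((1 + (gamGWv P.d P.L m a a')⁻¹ * eGW P.d P.L m a a') * (2 * P.d * Cst P.d a) * ((P.L : ℝ)⁻¹) ^ m)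
        (C1Tc P.d a (gamGWv P.d P.L m a a') (eGW P.d P.L m a a')
          (C2GW P.d P.L a (Cst P.d a ^ 2 * CMGW P.L m) (Cst P.d a ^ 2 * CSGW P.d P.L m a' (CbGW P.d P.L m a'))) * ((P.L : ℝ)⁻¹) ^ m)
        ((1 + epsGW P.d P.L m a a') ^ 2 * (C2Bs ι P.d P.L a (2 * α) (2 * β) C
          (a * C2gram (Cst P.d a) 1 (epsR ι P.d (2 * α)) (2 * P.d * Cst P.d a) (CJ P.d a) (Cst P.d a)
            (CdeltaR ι P.d a (2 * α) (theta0 P.d (2 * α) (betaNE3 ι C))))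
          (C4F ι P.d P.L a b' (2 * α) (2 * β) C) * ((P.L : ℝ)⁻¹) ^ m)) 0 1)
      ((P.L : ℝ)⁻¹) :=
  towerLimitRate_GW_balaban_of_regular (o := ι) P.L (unitMod P) m layer a a' ha P.hd P.hL.2 hlay ha'
    (regularTransporters_adjointField hF P U hα hβ hsize hlip) hC hNE3 hb' hαη hβη hη

end RootB

/-! ## §5 Non-vacuity: the binder set of §4 is jointly satisfiable (trivial configurations) -/

section NonVacuity

variable {n : Type} [Fintype n] [DecidableEq n] [Nonempty n] {ι : Type} [Fintype ι] [DecidableEq ι]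
variable {c : ℝ} {Pc : Submodule ℝ (Matrix n n ℂ)} {e : ι → Matrix n n ℂ} (hF : CompFamily c Pc e) (P : Params) (a : ℝ) (ha : 0 < a)

/-- **NON-VACUITY OF `balaban_final_rate_of_adjointField`**: at the trivial configurations `U_j ≡ 1` all displayed binders are discharged — `hsize`/`hlip` with
`α = β = 0`, `hNE3` with `C = 0` by `NE2BalabanFlatWitness.localRate_flat` (the adjoint tower of `1` is the trivial tower, `stowerOf_one`), `η := η⋆ ≥ 0`
(`etaStar_pos`) — so §4's conclusion holds with NO hypothesis at `U ≡ 1`.  Nothing about non-trivial backgrounds; NE2 NOT proved. [folklore] -/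
theorem balaban_final_rate_of_adjointField_one {a' : ℝ} (ha' : 0 < a') :
    TowerLimitRate (fun k => Qlev P.L (unitMod P) k ⊗ₖ (1 : Matrix ι ι ℂ)) ((P.L : ℝ) ^ P.d)
      (fun k => (calDalev P.L (unitMod P) a ha k ⊗ₖ (1 : Matrix ι ι ℂ)
        + balabanPert P.L (unitMod P) a (liftR P.L (unitMod P) (stowerOf P (adRep hF) fun j => (1 : GaugeField P j (Matrix.unitaryGroup n ℂ))))
            (gaugeSlot P.L (unitMod P) (stowerOf P (adRep hF) fun j => (1 : GaugeField P j (Matrix.unitaryGroup n ℂ)))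
              (QuT P.L (unitMod P) ι (siteT P.L (unitMod P) (stowerOf P (adRep hF) fun j => (1 : GaugeField P j (Matrix.unitaryGroup n ℂ)))))
              (Q1 P.L (unitMod P) ι) a') k)⁻¹)
      (Cpert (kappaBs ι P.d a (2 * 0) (2 * 0) (a * (epsR ι P.d (2 * 0) * (2 + epsR ι P.d (2 * 0)) * Cst P.d a))
          (kappa4F P.d a a' (2 * 0) (2 * 0)))
        (2 * P.d * Cst P.d a) (CJ P.d a)
        (C2Bs ι P.d P.L a (2 * 0) (2 * 0) 0
          (a * C2gram (Cst P.d a) 1 (epsR ι P.d (2 * 0)) (2 * P.d * Cst P.d a) (CJ P.d a) (Cst P.d a)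
            (CdeltaR ι P.d a (2 * 0) (theta0 P.d (2 * 0) (betaNE3 ι 0))))
          (C4F ι P.d P.L a a' (2 * 0) (2 * 0) 0)) 0 1) ((P.L : ℝ)⁻¹) := by
  have hη := etaStar_pos (o := ι) (d := P.d) a ha.le ha'.le
  have hθ : 0 ≤ ((P.L : ℝ)⁻¹) := inv_nonneg.mpr (Nat.cast_nonneg _)
  refine balaban_final_rate_of_adjointField hF P a ha (fun j => (1 : GaugeField P j (Matrix.unitaryGroup n ℂ))) le_rfl le_rfl ?_ ?_ le_rfl ?_
    ha' (by linarith) (by linarith) le_rfl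
  · intro k _ b
    rw [gaugeField_one_apply, OneMemClass.coe_one, sub_self, norm_zero, mul_zero]
  · intro k _ x ν μ
    rw [gaugeField_one_apply, gaugeField_one_apply, sub_self, norm_zero, mul_zero]
    positivity
  · rw [stowerOf_one]
    exact localRate_flat P.L (unitMod P) le_rfl hθ

end NonVacuity

end Summit.QuantumFields.BalabanUV.T4Continuum.NE2.AdjointFieldInstance

end
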